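import Summits.QuantumFields.QCD.Theses.QuarksAsStableAction
import Literature.MathematicalPhysics.QuantumLattice.WilsonDiracAP
import Literature.MathematicalPhysics.QuantumFieldTheory.QCDTransferMatrix
import Literature.MathematicalPhysics.QuantumFieldTheory.QCDTimeReflection

/-!
# Sketch (crux-ideate, round 1, ideator k = 2) — crux `UnquenchedChessboardBound` (stmt-QuantumFields-9735)

First lemmas of the two idea cards of this seat; statements only (`def … : Prop`), nothing asserted.

* Card `signed-partition-floor` (the load-bearing lemma of the universal-pattern bound): the
  `e^{-O(L⁴)}` floor on the SIGNED unquenched partition function for bare masses down to the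
  site-reflection-positivity edge `m > -1` (`κ < 1/6`), via the Lüscher–Smit slice transfer operator
  that the tree already renders (`QCDTransferMatrix.fermionSliceOp`, `gaugeSliceKernel`): the
  dictionary `SliceTraceFormula`, its static-field consequence, the pathwise heavy-window floor, the
  abstract moment log-convexity (Cauchy–Schwarz only), and the floor itself.
* Card `signed-pattern-chessboard`: the Fröhlich–Israel–Lieb–Simon abstract chessboard estimate
  (CMP 62 (1978) Thm 4.1, "longest string" proof) in LETTER form for every even period — the
  dissemination engine a SIGNED reflection-positive functional needs (no monotone replacement of
  observables is allowed there, so the tree's subsets-only dyadic `chessboard_pow_le` does not apply).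
-/

open MeasureTheory Matrix
open Literature.MathematicalPhysics.QuantumLattice Literature.MathematicalPhysics.QuantumFieldTheory
open Literature.Probability.LatticeModels (TorusSite)
open scoped ComplexOrder BigOperators InnerProductSpace

noncomputable section

namespace Summit.QuantumFields.QCD.Cruxes.UnquenchedChessboardBound.SketchIdeator2

local notation "SU3" => Matrix.specialUnitaryGroup (Fin 3) ℂ
local notation "ρ₃" => fundamentalRep (Fin 3)

/-! ### Card 1 — `signed-partition-floor` -/

/-- The UN-normalised signed unquenched partition function
`Ẑ(β, m⃗, L) = ∫ ∏_f det D_AP[U, m_f] e^{-β S_W(U)} ∏ dU_e` (Haar probability on every link; `D_AP`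
the crux's `r = 1` Wilson–Dirac operator antiperiodic in all four directions,
`QuantumLattice.wilsonDiracAP U m`, definitionally the crux's inlined `let apDet`). The crux's ratio is
`N̂_R / Ẑ` with both numerator and denominator against the same weight, so `Z_W` never appears. -/
def signedZhat (Nf L : ℕ) [NeZero L] (β : ℝ) (m : Fin Nf → ℝ) : ℂ :=
  ∫ U, (∏ f, fermionDet (Literature.MathematicalPhysics.QuantumLattice.wilsonDiracAP U (m f)))
    ∂(wilsonWeight (d := 4) (L := L) (G := SU3) ρ₃ β)

/-- **First lemma (load-bearing): the signed partition floor.** For every flavour number, mass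
window `[m_lo, m_hi] ⊂ (-1, ∞)` and slack `ε > 0` there is `a` such that for all `β ≥ 0`, all even
`L ≥ 4` and all masses in the window, `Re Ẑ ≥ exp(-(a + εβ) L⁴)` (and `Im Ẑ = 0`). This is the
only non-trivial input of the universal-pattern bound: the numerator of every universal pattern is
bounded pathwise by `∏_f (m_f + 8)^{12L⁴} · e^{-βδ·#pattern}`. -/
def SignedPartitionFloor : Prop :=
  ∀ (Nf : ℕ) (mlo mhi ε : ℝ), -1 < mlo → 0 < ε → ∃ a : ℝ, ∀ β : ℝ, 0 ≤ β →
    ∀ (L : ℕ) [NeZero L], Even L → 4 ≤ L → ∀ m : Fin Nf → ℝ, (∀ f, mlo ≤ m f ∧ m f ≤ mhi) →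
      Real.exp (-((a + ε * β) * (L : ℝ) ^ 4)) ≤ (signedZhat Nf L β m).re

/-- **Heavy-window floor (pathwise, provable now).** For `m > 0` (`κ < 1/8`) the antiperiodic Wilson
determinant is bounded below PATHWISE: `det D_AP[U, m] ≥ m^{12 L⁴}` for every `SU(3)` field —
`D = (m+4)(1 - E)` with `‖E‖ ≤ 4/(m+4)` (each of the four unit hopping matrices `P⁻_μ ⊗ V_μ + P⁺_μ ⊗ V_μ†`
is unitary), `log det(1 - E) ≥ 12L⁴ log(1 - ‖E‖)`, `det` real by γ₅-hermiticity. On windows with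
`m_lo > 0` the floor (hence the whole pattern bound) needs no transfer matrix. -/
def HeavyWindowFloor : Prop :=
  ∀ (L : ℕ) [NeZero L] (m : ℝ), 0 < m → ∀ U : GaugeConfig 4 L SU3,
    m ^ (12 * L ^ 4) ≤ (fermionDet (Literature.MathematicalPhysics.QuantumLattice.wilsonDiracAP U m)).re

/-- Spatial links of the time slice `x₀ = t` of a four-torus field, as a field on the three-torus
(three-torus direction `j` = four-torus direction `j.succ`, the convention of `QCDTransferMatrix`). -/
def spatialSlice {L : ℕ} (U : GaugeConfig 4 L SU3) (t : ZMod L) : GaugeConfig 3 L SU3 :=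
  fun e => U (Fin.cons t e.1, e.2.succ)

/-- Temporal links leaving the slice `x₀ = t`, read as a site function on the three-torus. -/
def temporalLayer {L : ℕ} (U : GaugeConfig 4 L SU3) (t : ZMod L) : TorusSite 3 L → SU3 :=
  fun x => U (Fin.cons t x, 0)

/-- One step of the slice product: the fermionic transfer operator of slice `t` (Smit (6.91), the
tree's `fermionSliceOp`) followed by the second-quantised parallel transport along the temporal
links leaving the slice: `Γ(V_t⁻¹ ⊗ 1₄)`, the tree's `fockGaugeAct` of the INVERSE temporal layer
(convention pinned by kit job j017042: `G = V† ⊗ 1₄` between the slice factors `t` and `t+1`,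
uniquely among {V, V†, chirally mixed} × positions, to `1e-11`). -/
def sliceStep {Nf L : ℕ} [NeZero L] (U : GaugeConfig 4 L SU3) (m : Fin Nf → ℝ) (t : ZMod L) :
    Matrix (Finset (SliceFermiIdx Nf L)) (Finset (SliceFermiIdx Nf L)) ℂ :=
  fockGaugeAct (Nf := Nf) (fun x => (temporalLayer U t x)⁻¹) * fermionSliceOp (spatialSlice U t) m

/-- **The dictionary (Lüscher 1977 / Smit (6.70)–(6.91)) for the tree's operators.** The product over
flavours of the TIME-antiperiodic Wilson determinants (`QuantumFieldTheory.wilsonDiracAP ρ₃ U m_f 1`,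
periodic in space; the all-directions-antiperiodic determinant of the crux differs only by the fixed
spatial `ℤ₂ ⊂ U(3)` seams riding inside the slice fields) is the Fock-space TRACE of the time-ordered
slice product — a finite-dimensional identity (block elimination in time using `P⁺P⁻ = 0`, plus the
tree's `trace_Gamma : Tr Γ(g) = det(1 + g)` and `Gamma_mul`), later slices to the LEFT. VERIFIED
numerically to `1e-12` relative on `4⁴` for time-dependent `SU(3)` fields, both time axes, masses
`-0.9 … 0.5`, with and without a twisted temporal layer (kit jobs j016981, j017042; the `A ↔ A⁻¹`
variant fails as control). The `m_f > -1` guard is only needed for `A⁻¹` to be the honest inverse. -/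
def SliceTraceFormula : Prop :=
  ∀ (Nf L : ℕ) [NeZero L] (m : Fin Nf → ℝ) (U : GaugeConfig 4 L SU3), (∀ f, -1 < m f) →
    (∏ f, fermionDet (Literature.MathematicalPhysics.QuantumFieldTheory.wilsonDiracAP ρ₃ U (m f) 1)) =
      Matrix.trace ((List.ofFn fun t : Fin L => sliceStep U m ((L - 1 - (t : ℕ) : ℕ) : ZMod L)).prod)

/-- **Static-field positivity (a checkable consequence of the dictionary).** For a gauge field that is
static along the time axis (spatial links independent of `x₀`, temporal links trivial) the slice
product is `P(U)^L` with ONE positive definite `P = T̂_F`, so the signed determinant is a sum of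
positive eigenvalue powers: `det D_AP[U, m] > 0` for every `m > -1`, however rough `U` is in space —
the sign problem of odd `N_f` is carried entirely by the time dependence of the gauge field (kit
job j016920: `117` static/non-static determinants on `4⁴` and `6⁴`, all consistent). -/
def StaticFieldPositivity : Prop :=
  ∀ (L : ℕ) [NeZero L] (m : ℝ), -1 < m → Even L → ∀ U : GaugeConfig 4 L SU3,
    (∀ x : TorusSite 4 L, U (x, 0) = 1) →
    (∀ (x : TorusSite 4 L) (j : Fin 4), j ≠ 0 → U (x + Pi.single 0 1, j) = U (x, j)) →
      0 < (fermionDet (Literature.MathematicalPhysics.QuantumLattice.wilsonDiracAP U m)).re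

/-- **Moment log-convexity (abstract, provable now, Cauchy–Schwarz only).** For a symmetric positive
linear map on a real inner-product space and a unit vector, `⟨Ω, TΩ⟩ⁿ ≤ ⟨Ω, Tⁿ Ω⟩`: the moments
`m_k = ⟨Ω, Tᵏ Ω⟩` are log-convex because `⟨x, Tx⟩ ≥ 0` and `⟨x, x⟩ ≥ 0` applied to
`x = Tᵃ Ω - s Tᵃ⁻¹ Ω` give `m_{2a}² ≤ m_{2a-1} m_{2a+1}` and `m_{2a+1}² ≤ m_{2a} m_{2a+2}`. With the
Hilbert–Schmidt doubling `Tr 𝒮^L = ‖𝒮^{L/2}‖²_HS ≥ ⟨Ω, 𝒮^{L/2} Ω⟩²` (even `L`) this turns ONE explicit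
Rayleigh quotient into a floor for the whole trace, with no spectral theorem and no trace-class theory. -/
def MomentLogConvexity : Prop :=
  ∀ (E : Type) [NormedAddCommGroup E] [InnerProductSpace ℝ E] (T : E →ₗ[ℝ] E),
    (∀ x y : E, ⟪T x, y⟫_ℝ = ⟪x, T y⟫_ℝ) → (∀ x : E, 0 ≤ ⟪x, T x⟫_ℝ) →
      ∀ (Ω : E) (n : ℕ), ‖Ω‖ = 1 → ⟪Ω, T Ω⟫_ℝ ^ n ≤ ⟪Ω, (T ^ n) Ω⟫_ℝ

/-- **The vacuum Rayleigh quotient of the slice transfer operator is pathwise explicit.** With the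
constant vacuum wave `Ω(U) = |0⟩` (in the tree's `transferCore`), the numerator of the Rayleigh quotient
`transferForm β m Ω Ω = ∫∫ K_β(U,U') (det A_red(U))² (det A_red(U'))² dU dU'` and the denominator
`fermionWeightForm m Ω Ω = ∫ (det A_red(U))² dU` (`fermionWeightForm_vacuum`, proved in the tree) are
integrals of PATHWISE POSITIVE functions, and `A(U) ≥ m + 1` (`‖½Σ_j(W_j + W_j†)‖ ≤ 3`),
`A(U) ≤ m + 7`, so the quotient is at least `((m_lo+1)/(m_hi+7))^{c L³} · ∫∫ K_β`. This is the
Rayleigh quotient that `MomentLogConvexity` + Hilbert–Schmidt doubling raise to the power `L`. -/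
def VacuumRayleighFloor : Prop :=
  ∀ (Nf : ℕ) (mlo mhi ε : ℝ), -1 < mlo → 0 < ε → ∃ a : ℝ, ∀ β : ℝ, 0 ≤ β → ∀ (S : ℕ) [NeZero S],
    ∀ m : Fin Nf → ℝ, (∀ f, mlo ≤ m f ∧ m f ≤ mhi) →
      Real.exp (-((a + ε * β) * (S : ℝ) ^ 3)) * (fermionWeightForm (S := S) m (fun _ => vacuum) (fun _ => vacuum)).re ≤
        (transferForm (S := S) β m (fun _ => vacuum) (fun _ => vacuum)).re

/-! ### Card 2 — `signed-pattern-chessboard` -/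

/-- **First lemma: the abstract chessboard estimate in letter form, every even period** (FILS 1978
Thm 4.1 with `𝔄₀` replaced by an alphabet `α` carrying the reflection `r`; the "longest string"
proof uses only cyclic invariance, the reflection Cauchy–Schwarz across ONE pair of planes, and the
freedom to replace letters by their reflections — no linear structure, no monotonicity, no dyadic side).
Words `w : ZMod N → α` assign a letter to each of the `N` slabs between consecutive reflection planes of
one direction; `Φ w` is the (real) value of the signed RP functional on the product of the slab
observables. Conclusion: `|Φ w| ≤ ∏_i Φ(universal pattern of the letter w i)^{1/N}`. -/
def PatternChessboard : Prop :=
  ∀ (N : ℕ) [NeZero N] (α : Type) (r : α → α) (Φ : (ZMod N → α) → ℝ), Even N → Function.Involutive r →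
    (∀ w : ZMod N → α, Φ (fun i => w (i + 1)) = Φ w) →
    (∀ u : ZMod N → α, 0 ≤ Φ (fun i => if i.val < N / 2 then u i else r (u (-1 - i)))) →
    (∀ u v : ZMod N → α,
        Φ (fun i => if i.val < N / 2 then u i else v i) ^ 2 ≤
          Φ (fun i => if i.val < N / 2 then u i else r (u (-1 - i))) *
            Φ (fun i => if i.val < N / 2 then r (v (-1 - i)) else v i)) →
    ∀ w : ZMod N → α,
      |Φ w| ≤ ∏ i : ZMod N, Φ (fun j => if Even j.val then w i else r (w i)) ^ (1 / (N : ℝ))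

end Summit.QuantumFields.QCD.Cruxes.UnquenchedChessboardBound.SketchIdeator2
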